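import Mathlib
import Literature.NumberTheory.Transcendental.BakerLinearFormsQuantitativeProofs
import Summits.Schanuel.Schanuel.Theorems.RigidCoreSchanuelOnLogFreeCorePiPowersTH
import Summits.Schanuel.Schanuel.Theses.RigidCore

/-!
# Linear cusps carry a finite BAKER DEPTH CAP (pocket `stub_bakerDepthCapRay`, lead c3)

Pocket of the line `cusp-germ-schneider-sparsity` for the crux `RigidCore.SparsityTwo` (item
stmt-Schanuel-0971), answering the crux idea `a2-depth-cap-baker31` (idea-node g7, 2026-08-16).
In the algebraic uniformiser `t` of a LINEAR cusp of a `ℚ`-curve the hits `n` satisfy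
`(t n)⁻ᵉ = 2πi n + c n` (`c n` convergent) and the hit identity
`2πi L = 2πi β n + Φ(t n) + (β l₀ − l₁)`, `L ∈ ℤ`, where `β` is the algebraic irrational slope,
`l₀, l₁` are logarithms of the algebraic cusp values and `Φ` is the defect germ (analytic at `0`,
`Φ 0 = g₀` algebraic).  So at a hit the LINEAR FORM IN LOGARITHMS WITH ALGEBRAIC COEFFICIENTS
`Λ = g₀ + (βn)·2πi + β·l₀ + (−L)·2πi + (−1)·l₁` equals `g₀ − Φ(t n)`, which is `O(‖t n‖^{K+1})
= O(n^{−(K+1)/e})` if `Φ` is flat to order `K` at `0`, while its coefficients have degree `≤ D` and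
height `≤ C₁ n^D`.  BAKER'S THEOREM 3.1 — PROVED in the tree,
`Literature.NumberTheory.Transcendental.baker1975_thm_3_1_holds` — gives `Λ = 0 ∨ |Λ| > (C₁ n^D)^{−C}`,
so for `K + 1 = e (D ⌈C⌉ + 1)` only finitely many hits have `Λ ≠ 0`; and `Λ = 0` pins `L − βn`,
which for irrational `β` happens for at most one `n`.  Hence: for every `(e, β, g₀, l₀, l₁)` there is a
DEPTH CAP `K` such that a defect germ flat to order `K` has finitely many hits
(`stub_bakerDepthCapRay`).  For the torsion-homogeneous linear cusp (atom A1) the Roth pocket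
`stub_rothCuspFinite` caps the depth at `e`; the present pocket is what bounds the depth of the
INHOMOGENEOUS linear cusp (atom A2, `InhomogeneousCuspAtom`), whose open content is therefore "exact
inhomogeneous hits at depth `≤ K_Baker`" — see `RigidCoreSparsityTwoBakerDepthCap.lean` for the
`CuspDatum` form.  No unproved facts; axioms standard.
-/

set_option linter.dupNamespace false

namespace Summit.Schanuel.Schanuel.Cruxes.SparsityTwo.CuspGermSchneiderSparsity

open Filter Topology Complex Polynomial Literature.NumberTheory.Transcendental
open scoped Real
open Summit.Schanuel.Schanuel.Theorems.RigidCore.KernelTower (coeff_sum_monomial sum_monomial_ne_zero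
  natDegree_sum_monomial_le abs_coeff_sum_monomial_le aeval_sum_monomial)

/-! ## Integer witness polynomials -/

/-- A `ℚ`-algebraic complex number is a root of a non-zero INTEGER polynomial (clear denominators). [folklore] -/
theorem exists_intPoly_of_isAlgebraic {x : ℂ} (hx : IsAlgebraic ℚ x) : ∃ P : ℤ[X], P ≠ 0 ∧ aeval x P = 0 := by
  obtain ⟨p, hp0, hp⟩ := hx
  refine ⟨IsLocalization.integerNormalization (nonZeroDivisors ℤ) p, ?_,
    IsLocalization.integerNormalization_aeval_eq_zero (nonZeroDivisors ℤ) p hp⟩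
  rw [Ne, IsLocalization.integerNormalization_eq_zero_iff le_rfl]
  exact hp0

/-- Every integer polynomial has a (naive) height bound `h : ℕ`. [folklore] -/
theorem exists_height_bound (P : ℤ[X]) : ∃ h : ℕ, ∀ j, |P.coeff j| ≤ (h : ℤ) := by
  refine ⟨∑ j ∈ P.support, (P.coeff j).natAbs, fun j => ?_⟩
  have hcast : ((∑ i ∈ P.support, (P.coeff i).natAbs : ℕ) : ℤ) = ∑ i ∈ P.support, |P.coeff i| := by
    push_cast
    rfl
  rw [hcast]
  by_cases hj : j ∈ P.support
  · exact Finset.single_le_sum (f := fun i => |P.coeff i|) (fun i _ => abs_nonneg _) hj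
  · rw [Polynomial.notMem_support_iff.mp hj, abs_zero]
    exact Finset.sum_nonneg (fun i _ => abs_nonneg _)

/-- Baker-format witness for an INTEGER `m`: the polynomial `X + m` has root `−m`, degree `1` and height
`max(|m|, 1)`. [folklore] -/
theorem intWitness (m : ℤ) {d : ℕ} (hd : 1 ≤ d) {B : ℕ} (hB : |m| ≤ (B : ℤ)) (hB1 : 1 ≤ B) :
    ∃ Q : ℤ[X], Q ≠ 0 ∧ Q.natDegree ≤ d ∧ (∀ k, |Q.coeff k| ≤ (B : ℤ)) ∧ aeval (-(m : ℂ)) Q = 0 := by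
  refine ⟨X + C m, X_add_C_ne_zero m, by rw [natDegree_X_add_C]; exact hd, fun k => ?_, ?_⟩
  · rw [coeff_add, coeff_X, coeff_C]
    rcases eq_or_ne k 0 with rfl | hk0
    · simpa using hB
    · rcases eq_or_ne k 1 with rfl | hk1
      · simp
        exact_mod_cast hB1
      · simp [hk0, Ne.symm hk1]
  · rw [map_add, aeval_X, aeval_C, algebraMap_int_eq, eq_intCast]
    ring

/-- Baker-format witness for `β·n` from one for `β`: if `P(β) = 0` (`P ∈ ℤ[X]`, degree `d`, height `≤ H`)
then `Q_n = ∑_{j ≤ d} P_j n^{d−j} X^j` has `Q_n(βn) = n^d P(β) = 0`, degree `≤ d + 1` and height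
`≤ (d+1) H n^d`. [folklore] -/
theorem scaledWitness {β : ℂ} {P : ℤ[X]} (hP0 : P ≠ 0) (hP : aeval β P = 0) {H : ℕ}
    (hH : ∀ j, |P.coeff j| ≤ (H : ℤ)) (n : ℕ) (hn : 1 ≤ n) :
    ∃ Q : ℤ[X], Q ≠ 0 ∧ Q.natDegree ≤ P.natDegree + 1 ∧
      (∀ k, |Q.coeff k| ≤ (((P.natDegree + 1) * H * n ^ P.natDegree : ℕ) : ℤ)) ∧ aeval (β * n) Q = 0 := by
  set d := P.natDegree with hd
  set h : Fin (d + 1) → ℤ := fun j => P.coeff j * (n : ℤ) ^ (d - j) with hh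
  refine ⟨∑ j : Fin (d + 1), monomial (j : ℕ) (h j), sum_monomial_ne_zero ?_, natDegree_sum_monomial_le h,
    fun k => (abs_coeff_sum_monomial_le h k).trans ?_, ?_⟩
  · -- `h_d = leading coefficient ≠ 0`
    intro h0
    have h1 : h ⟨d, Nat.lt_succ_self d⟩ = 0 := by rw [h0]; rfl
    simp only [hh, Nat.sub_self, pow_zero, mul_one] at h1
    exact hP0 (leadingCoeff_eq_zero.mp h1)
  · -- height
    have hn1 : (1 : ℤ) ≤ n := by exact_mod_cast hn
    calc ∑ j : Fin (d + 1), |h j| ≤ ∑ _j : Fin (d + 1), (H : ℤ) * (n : ℤ) ^ d := by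
          refine Finset.sum_le_sum fun j _ => ?_
          rw [hh, abs_mul, abs_pow, abs_of_nonneg (by positivity : (0 : ℤ) ≤ n)]
          exact mul_le_mul (hH j) (pow_le_pow_right₀ hn1 (Nat.sub_le _ _)) (by positivity) (by positivity)
      _ = (((d + 1) * H * n ^ d : ℕ) : ℤ) := by
          rw [Finset.sum_const, Finset.card_univ, Fintype.card_fin]
          push_cast
          ring
  · -- `Q_n(βn) = n^d P(β)`
    rw [aeval_sum_monomial]
    have hterm : ∀ j : Fin (d + 1), ((h j : ℤ) : ℂ) * (β * n) ^ (j : ℕ) =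
        (n : ℂ) ^ d * ((P.coeff j : ℂ) * β ^ (j : ℕ)) := by
      intro j
      have hj : (j : ℕ) ≤ d := Nat.lt_succ_iff.mp j.is_lt
      simp only [hh, Int.cast_mul, Int.cast_pow, Int.cast_natCast, mul_pow]
      rw [← pow_sub_mul_pow (n : ℂ) hj]
      ring
    simp_rw [hterm, ← Finset.mul_sum]
    have hsum : ∑ j : Fin (d + 1), (P.coeff j : ℂ) * β ^ (j : ℕ) = aeval β P := by
      rw [Fin.sum_univ_eq_sum_range (fun j => (P.coeff j : ℂ) * β ^ j) (d + 1), aeval_eq_sum_range, ← hd]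
      simp [Algebra.smul_def]
    rw [hsum, hP, mul_zero]

/-! ## The pocket -/

/-- Elementary arithmetic of the final comparison (natural powers only): `1 < s^{K+1} M b^{k₀}`
with `K + 1 = e(Dk₀+1)`, `n s^e ≤ 1`, `b ≤ C₁ n^D`, `n ≥ M C₁^{k₀}`, `n ≥ 1` is impossible. -/
theorem bakerDepthCap_arith {e D k₀ : ℕ} {s M b C₁ n : ℝ} (hs : 0 ≤ s) (hM : 0 ≤ M) (hb : 0 ≤ b) (hC₁ : 0 ≤ C₁)
    (hn : 1 ≤ n) (hsn : n * s ^ e ≤ 1) (hbB : b ≤ C₁ * n ^ D) (hbig : M * C₁ ^ k₀ ≤ n)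
    (hX : 1 < s ^ (e * (D * k₀ + 1)) * M * b ^ k₀) : False := by
  have hn0 : 0 < n := by linarith
  have h1 : s ^ (e * (D * k₀ + 1)) * n ^ (D * k₀ + 1) ≤ 1 := by
    rw [pow_mul, ← mul_pow, mul_comm]
    exact pow_le_one₀ (by positivity) hsn
  have h2 : b ^ k₀ ≤ C₁ ^ k₀ * n ^ (D * k₀) := by
    calc b ^ k₀ ≤ (C₁ * n ^ D) ^ k₀ := pow_le_pow_left₀ hb hbB _
      _ = C₁ ^ k₀ * n ^ (D * k₀) := by rw [mul_pow, ← pow_mul]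
  have h3 : s ^ (e * (D * k₀ + 1)) * M * b ^ k₀ * n ^ (D * k₀ + 1) ≤ n ^ (D * k₀ + 1) := by
    calc s ^ (e * (D * k₀ + 1)) * M * b ^ k₀ * n ^ (D * k₀ + 1)
        ≤ s ^ (e * (D * k₀ + 1)) * M * (C₁ ^ k₀ * n ^ (D * k₀)) * n ^ (D * k₀ + 1) := by gcongr
      _ = (s ^ (e * (D * k₀ + 1)) * n ^ (D * k₀ + 1)) * (M * C₁ ^ k₀) * n ^ (D * k₀) := by ring
      _ ≤ 1 * n * n ^ (D * k₀) := by gcongr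
      _ = n ^ (D * k₀ + 1) := by ring
  have h4 : n ^ (D * k₀ + 1) < s ^ (e * (D * k₀ + 1)) * M * b ^ k₀ * n ^ (D * k₀ + 1) := by
    have := mul_lt_mul_of_pos_right hX (pow_pos hn0 (D * k₀ + 1))
    rwa [one_mul] at this
  linarith

/-- **stub_bakerDepthCapRay** (POCKET "Baker depth cap" of the LINEAR cusp; registered stub).
For `e ≥ 1`, `β` algebraic irrational, `g₀` algebraic and logarithms `l₀, l₁` of algebraic numbers
there is `K : ℕ` such that: if `Φ` is analytic at `0` with `Φ 0 = g₀` and `Φ⁽ʲ⁾(0) = 0` for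
`1 ≤ j ≤ K`, `t n → 0`, `c n` converges and eventually `(t n)⁻ᵉ = 2πi n + c n`, then only finitely many
`n` admit `L ∈ ℤ` with `2πi L = 2πi β n + Φ(t n) + (β l₀ − l₁)`.  Proof: Baker 1975 Thm 3.1 (tree
theorem `baker1975_thm_3_1_holds`) for the form `g₀ + (βn)·2πi + β·l₀ + (−L)·2πi + (−1)·l₁ = g₀ − Φ(t n)`
with witnesses of degree `≤ D` and height `≤ C₁ n^D`, against `‖g₀ − Φ(t n)‖ ≤ (‖F 0‖+1) ‖t n‖^{K+1}`,
`n ‖t n‖ᵉ ≤ 1`, `K + 1 = e(D⌈C⌉ + 1)`; the alternative `Λ = 0` occurs for at most one `n`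
(`β ∉ ℚ`). -/
theorem stub_bakerDepthCapRay :
    ∀ (e : ℕ) (β g₀ l₀ l₁ : ℂ), 0 < e → IsAlgebraic ℚ β → (∀ r' : ℚ, (r' : ℂ) ≠ β) →
      IsAlgebraic ℚ g₀ → IsAlgebraic ℚ (Complex.exp l₀) → IsAlgebraic ℚ (Complex.exp l₁) →
      ∃ K : ℕ, ∀ (Φ : ℂ → ℂ) (t c : ℕ → ℂ) (lam : ℂ),
        AnalyticAt ℂ Φ 0 → Φ 0 = g₀ → (∀ j : ℕ, 1 ≤ j → j ≤ K → iteratedDeriv j Φ 0 = 0) →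
        Tendsto t atTop (𝓝 0) → Tendsto c atTop (𝓝 lam) →
        (∀ᶠ n : ℕ in atTop, t n ≠ 0 ∧ ((t n) ^ e)⁻¹ = 2 * ↑π * I * (n : ℂ) + c n) →
        Set.Finite {n : ℕ | ∃ L : ℤ,
          2 * ↑π * I * (L : ℂ) = 2 * ↑π * I * β * n + Φ (t n) + (β * l₀ - l₁)} := by
  intro e β g₀ l₀ l₁ he hβalg hβirr hg₀ hα₀ hα₁
  classical
  -- integer witnesses and heights of the fixed algebraic numbers
  obtain ⟨Pβ, hPβ0, hPβ⟩ := exists_intPoly_of_isAlgebraic hβalg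
  obtain ⟨Pg, hPg0, hPg⟩ := exists_intPoly_of_isAlgebraic hg₀
  obtain ⟨P₀, hP₀0, hP₀⟩ := exists_intPoly_of_isAlgebraic hα₀
  obtain ⟨P₁, hP₁0, hP₁⟩ := exists_intPoly_of_isAlgebraic hα₁
  obtain ⟨Hβ, hHβ⟩ := exists_height_bound Pβ
  obtain ⟨Hg, hHg⟩ := exists_height_bound Pg
  obtain ⟨H₀, hH₀⟩ := exists_height_bound P₀
  obtain ⟨H₁, hH₁⟩ := exists_height_bound P₁
  -- common degree bound `D ≥ 1` and height bound `A ≥ 1` for the logarithms' witnesses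
  obtain ⟨D, hD⟩ : ∃ D : ℕ, D = Pβ.natDegree + 1 + Pg.natDegree + P₀.natDegree + P₁.natDegree + 1 := ⟨_, rfl⟩
  obtain ⟨A, hA⟩ : ∃ A : ℕ, A = H₀ + H₁ + 1 := ⟨_, rfl⟩
  have hD1 : 1 ≤ D := by omega
  have h2pi : (2 * (π : ℂ) * I) ≠ 0 := by simp [Real.pi_ne_zero, I_ne_zero]
  have hexp2pi : Complex.exp (2 * ↑π * I) = 1 := Complex.exp_two_pi_mul_I
  -- the logarithms `(2πi, l₀, 2πi, l₁)` of `(1, e^{l₀}, 1, e^{l₁})`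
  let α : Fin 4 → ℂ := ![1, Complex.exp l₀, 1, Complex.exp l₁]
  let l : Fin 4 → ℂ := ![2 * ↑π * I, l₀, 2 * ↑π * I, l₁]
  have hα : ∀ i, α i ≠ 0 := by
    intro i
    fin_cases i <;> simp [α, Complex.exp_ne_zero]
  have hl : ∀ i, Complex.exp (l i) = α i := by
    intro i
    fin_cases i <;> simp [α, l, hexp2pi]
  have hone : ∃ P : ℤ[X], P ≠ 0 ∧ P.natDegree ≤ D ∧ (∀ j, |P.coeff j| ≤ (A : ℤ)) ∧ aeval (1 : ℂ) P = 0 := by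
    obtain ⟨Q, hQ0, hQd, hQc, hQ⟩ := intWitness (-1) hD1 (B := A) (by simp; omega) (by omega)
    exact ⟨Q, hQ0, hQd, hQc, by simpa using hQ⟩
  have hwitα : ∀ i, ∃ P : ℤ[X], P ≠ 0 ∧ P.natDegree ≤ D ∧ (∀ j, |P.coeff j| ≤ (A : ℤ)) ∧
      aeval (α i) P = 0 := by
    intro i
    fin_cases i
    · simpa [α] using hone
    · exact ⟨P₀, hP₀0, by omega, fun j => (hH₀ j).trans (by omega), by simpa [α] using hP₀⟩
    · simpa [α] using hone
    · exact ⟨P₁, hP₁0, by omega, fun j => (hH₁ j).trans (by omega), by simpa [α] using hP₁⟩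
  -- BAKER
  obtain ⟨C, hC, hBaker⟩ := baker1975_thm_3_1_holds 4 D A α l hα hl hwitα
  obtain ⟨k₀, hk₀⟩ : ∃ k₀ : ℕ, k₀ = ⌈C⌉₊ := ⟨_, rfl⟩
  have hK0 : 0 < e * (D * k₀ + 1) := Nat.mul_pos he (Nat.succ_pos _)
  refine ⟨e * (D * k₀ + 1) - 1, ?_⟩ -- the depth cap `K = e (D ⌈C⌉ + 1) - 1`
  intro Φ t c lam hΦan hΦ0 hvan ht hc hrel
  -- Taylor: `Φ z = g₀ + z^(K+1) F z`
  obtain ⟨F, hF, hΦeq⟩ := hΦan.exists_eq_sum_add_pow_mul (e * (D * k₀ + 1))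
  have hΦeq' : ∀ z, Φ z - g₀ = z ^ (e * (D * k₀ + 1)) * F z := by
    intro z
    rw [hΦeq z, Finset.sum_eq_single 0, smul_eq_mul]
    · simp [hΦ0]
    · intro i hi hi0
      rw [Finset.mem_range] at hi
      rw [hvan i (Nat.one_le_iff_ne_zero.mpr hi0) (by omega), smul_zero]
    · intro h0
      exact absurd (Finset.mem_range.mpr hK0) h0
  have hFt : Tendsto (fun n => F (t n)) atTop (𝓝 (F 0)) := hF.continuousAt.tendsto.comp ht
  have hFb : ∀ᶠ n in atTop, ‖F (t n)‖ ≤ ‖F 0‖ + 1 :=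
    hFt.norm.eventually (eventually_le_nhds (lt_add_one _))
  have hΦt : Tendsto (fun n => Φ (t n)) atTop (𝓝 g₀) := by
    have h := hΦan.continuousAt.tendsto.comp ht
    rwa [hΦ0] at h
  have hΦb : ∀ᶠ n in atTop, ‖Φ (t n)‖ ≤ ‖g₀‖ + 1 :=
    hΦt.norm.eventually (eventually_le_nhds (lt_add_one _))
  have hcb : ∀ᶠ n in atTop, ‖c n‖ ≤ ‖lam‖ + 1 :=
    hc.norm.eventually (eventually_le_nhds (lt_add_one _))
  -- the height constant `C₁` and the size constant `M`
  obtain ⟨Lc, hLc⟩ : ∃ Lc : ℕ, Lc = ⌈‖β‖⌉₊ + ⌈‖g₀‖ + 1 + ‖β * l₀ - l₁‖⌉₊ := ⟨_, rfl⟩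
  obtain ⟨C₁, hC₁⟩ : ∃ C₁ : ℕ, C₁ = (Pβ.natDegree + 1) * Hβ + Hg + Hβ + Lc + 2 := ⟨_, rfl⟩
  obtain ⟨M, hMdef⟩ : ∃ M : ℝ, M = ‖F 0‖ + 1 := ⟨_, rfl⟩
  have hM0 : 0 ≤ M := by rw [hMdef]; positivity
  have h2piI : ‖(2 * (π : ℂ) * I)‖ = 2 * π := by
    rw [norm_mul, norm_mul, Complex.norm_I, mul_one, Complex.norm_real, Complex.norm_ofNat,
      Real.norm_eq_abs, abs_of_pos Real.pi_pos]
  /- KEY: at every late hit the Baker form vanishes -/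
  have key : ∀ᶠ n : ℕ in atTop, ∀ L : ℤ,
      2 * ↑π * I * (L : ℂ) = 2 * ↑π * I * β * n + Φ (t n) + (β * l₀ - l₁) →
      g₀ + β * n * (2 * ↑π * I) + β * l₀ + -(L : ℂ) * (2 * ↑π * I) + -1 * l₁ = 0 := by
    filter_upwards [hrel, hFb, hΦb, hcb,
      (tendsto_natCast_atTop_atTop (R := ℝ)).eventually_ge_atTop (‖lam‖ + 1),
      (tendsto_natCast_atTop_atTop (R := ℝ)).eventually_ge_atTop (M * (C₁ : ℝ) ^ k₀),
      eventually_ge_atTop 1] with n hn hFn hΦn hcn hnlam hnbig hn1 L hL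
    have hn1' : (1 : ℝ) ≤ n := by exact_mod_cast hn1
    -- size of `L`
    have hLbound : |L| ≤ ((Lc * n : ℕ) : ℤ) := by
      have h1 : ‖(2 * ↑π * I) * ((L : ℂ) - β * n)‖ = ‖Φ (t n) + (β * l₀ - l₁)‖ := by
        congr 1
        linear_combination hL
      rw [norm_mul, h2piI] at h1
      have h2 : ‖(L : ℂ) - β * n‖ ≤ ‖g₀‖ + 1 + ‖β * l₀ - l₁‖ := by
        have h3 : 2 * π * ‖(L : ℂ) - β * n‖ ≤ 2 * π * (‖g₀‖ + 1 + ‖β * l₀ - l₁‖) := by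
          rw [h1]
          calc ‖Φ (t n) + (β * l₀ - l₁)‖ ≤ ‖Φ (t n)‖ + ‖β * l₀ - l₁‖ := norm_add_le _ _
            _ ≤ ‖g₀‖ + 1 + ‖β * l₀ - l₁‖ := by linarith
            _ ≤ 2 * π * (‖g₀‖ + 1 + ‖β * l₀ - l₁‖) := by
                have : (1 : ℝ) ≤ 2 * π := by linarith [Real.pi_gt_three]
                nlinarith [norm_nonneg (β * l₀ - l₁), norm_nonneg g₀]
        exact le_of_mul_le_mul_left h3 (by positivity)
      have h4 : ‖(L : ℂ)‖ ≤ ‖β‖ * n + (‖g₀‖ + 1 + ‖β * l₀ - l₁‖) := by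
        calc ‖(L : ℂ)‖ = ‖((L : ℂ) - β * n) + β * n‖ := by ring_nf
          _ ≤ ‖(L : ℂ) - β * n‖ + ‖β * (n : ℂ)‖ := norm_add_le _ _
          _ ≤ (‖g₀‖ + 1 + ‖β * l₀ - l₁‖) + ‖β‖ * n := by
              rw [norm_mul, Complex.norm_natCast]; linarith
          _ = ‖β‖ * n + (‖g₀‖ + 1 + ‖β * l₀ - l₁‖) := by ring
      have h5 : |(L : ℝ)| ≤ (Lc : ℝ) * n := by
        have hL' : ‖(L : ℂ)‖ = |(L : ℝ)| := by rw [Complex.norm_intCast]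
        rw [hL'] at h4
        calc |(L : ℝ)| ≤ ‖β‖ * n + (‖g₀‖ + 1 + ‖β * l₀ - l₁‖) := h4
          _ ≤ ⌈‖β‖⌉₊ * n + ⌈‖g₀‖ + 1 + ‖β * l₀ - l₁‖⌉₊ * n := by
              have ha := Nat.le_ceil ‖β‖
              have hb := Nat.le_ceil (‖g₀‖ + 1 + ‖β * l₀ - l₁‖)
              nlinarith [norm_nonneg β, norm_nonneg g₀, norm_nonneg (β * l₀ - l₁)]
          _ = (Lc : ℝ) * n := by rw [hLc]; push_cast; ring
      exact_mod_cast h5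
    -- the Baker parameters at this hit
    obtain ⟨Bn, hBn⟩ : ∃ Bn : ℕ, Bn = C₁ * n ^ D := ⟨_, rfl⟩
    have hnD : n ≤ n ^ D := by
      calc n = n ^ 1 := (pow_one n).symm
        _ ≤ n ^ D := Nat.pow_le_pow_right hn1 hD1
    have hnD1 : 1 ≤ n ^ D := hn1.trans hnD
    have hC₁2 : 2 ≤ C₁ := by omega
    have hBn2 : 2 ≤ Bn := by
      rw [hBn]
      calc 2 ≤ C₁ := hC₁2
        _ = C₁ * 1 := (mul_one _).symm
        _ ≤ C₁ * n ^ D := Nat.mul_le_mul_left _ hnD1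
    have hC₁Bn : ∀ {x : ℤ}, x ≤ C₁ → x ≤ (Bn : ℤ) := fun {x} hx => by
      calc x ≤ C₁ := hx
        _ = (C₁ : ℤ) * 1 := (mul_one _).symm
        _ ≤ (C₁ : ℤ) * (n ^ D : ℕ) := by gcongr; exact_mod_cast hnD1
        _ = (Bn : ℤ) := by rw [hBn]; push_cast; ring
    let β' : Fin 5 → ℂ := ![g₀, β * n, β, -(L : ℂ), -1]
    -- witnesses of the five coefficients
    have hw0 : ∃ Q : ℤ[X], Q ≠ 0 ∧ Q.natDegree ≤ D ∧ (∀ k, |Q.coeff k| ≤ (Bn : ℤ)) ∧ aeval g₀ Q = 0 :=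
      ⟨Pg, hPg0, by omega, fun k => (hHg k).trans (hC₁Bn (by omega)), hPg⟩
    have hw1 : ∃ Q : ℤ[X], Q ≠ 0 ∧ Q.natDegree ≤ D ∧ (∀ k, |Q.coeff k| ≤ (Bn : ℤ)) ∧
        aeval (β * n) Q = 0 := by
      obtain ⟨Q, hQ0, hQd, hQc, hQ⟩ := scaledWitness hPβ0 hPβ hHβ n hn1
      refine ⟨Q, hQ0, by omega, fun k => (hQc k).trans ?_, hQ⟩
      rw [hBn, hC₁]
      push_cast
      have h1 : ((n : ℤ) ^ Pβ.natDegree : ℤ) ≤ (n : ℤ) ^ D :=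
        pow_le_pow_right₀ (by exact_mod_cast hn1) (by omega)
      have h2 : (0 : ℤ) ≤ (n : ℤ) ^ Pβ.natDegree := by positivity
      have h3 : (0 : ℤ) ≤ (n : ℤ) ^ D := by positivity
      nlinarith
    have hw2 : ∃ Q : ℤ[X], Q ≠ 0 ∧ Q.natDegree ≤ D ∧ (∀ k, |Q.coeff k| ≤ (Bn : ℤ)) ∧ aeval β Q = 0 :=
      ⟨Pβ, hPβ0, by omega, fun k => (hHβ k).trans (hC₁Bn (by omega)), hPβ⟩
    have hw3 : ∃ Q : ℤ[X], Q ≠ 0 ∧ Q.natDegree ≤ D ∧ (∀ k, |Q.coeff k| ≤ (Bn : ℤ)) ∧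
        aeval (-(L : ℂ)) Q = 0 := by
      have hLB : |L| ≤ (Bn : ℤ) := by
        refine hLbound.trans ?_
        rw [hBn]
        push_cast
        have h1 : (n : ℤ) ≤ (n : ℤ) ^ D := by exact_mod_cast hnD
        have h2 : (Lc : ℤ) ≤ C₁ := by omega
        have h3 : (0 : ℤ) ≤ n := by positivity
        nlinarith
      exact intWitness L hD1 hLB (by omega)
    have hw4 : ∃ Q : ℤ[X], Q ≠ 0 ∧ Q.natDegree ≤ D ∧ (∀ k, |Q.coeff k| ≤ (Bn : ℤ)) ∧
        aeval (-(1 : ℂ)) Q = 0 := by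
      simpa using intWitness 1 hD1 (B := Bn) (by simp; omega) (by omega)
    have hwit : ∀ j, ∃ Q : ℤ[X], Q ≠ 0 ∧ Q.natDegree ≤ D ∧ (∀ k, |Q.coeff k| ≤ (Bn : ℤ)) ∧
        aeval (β' j) Q = 0 := by
      intro j
      fin_cases j
      · simpa [β'] using hw0
      · simpa [β'] using hw1
      · simpa [β'] using hw2
      · simpa [β'] using hw3
      · simpa [β'] using hw4
    -- the form is `g₀ − Φ(t n)`
    have hform : β' 0 + ∑ i : Fin 4, β' i.succ * l i =
        g₀ + β * n * (2 * ↑π * I) + β * l₀ + -(L : ℂ) * (2 * ↑π * I) + -1 * l₁ := by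
      simp only [Fin.sum_univ_four]
      simp [β', l]
      ring
    have hΛ : g₀ + β * n * (2 * ↑π * I) + β * l₀ + -(L : ℂ) * (2 * ↑π * I) + -1 * l₁ = g₀ - Φ (t n) := by
      linear_combination (-1 : ℂ) * hL
    rcases hBaker Bn hBn2 β' hwit with hzero | hlb
    · rwa [hform] at hzero
    · -- the lower bound contradicts the flatness of `Φ`
      exfalso
      rw [hform, hΛ] at hlb
      have hs : 0 < ‖t n‖ := norm_pos_iff.mpr hn.1
      -- `Bn^{-C} ≥ (Bn^{k₀})⁻¹`
      have hBn1 : (1 : ℝ) ≤ (Bn : ℝ) := by exact_mod_cast (show 1 ≤ Bn by omega)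
      have hlb' : ((Bn : ℝ) ^ k₀)⁻¹ < ‖g₀ - Φ (t n)‖ := by
        refine lt_of_le_of_lt ?_ hlb
        rw [← Real.rpow_natCast, ← Real.rpow_neg (by positivity), hk₀]
        exact Real.rpow_le_rpow_of_exponent_le hBn1 (neg_le_neg (Nat.le_ceil C))
      -- `‖g₀ − Φ(t n)‖ ≤ ‖t n‖^{K+1} M`
      have hup : ‖g₀ - Φ (t n)‖ ≤ ‖t n‖ ^ (e * (D * k₀ + 1)) * M := by
        rw [norm_sub_rev, hΦeq' (t n), norm_mul, norm_pow, hMdef]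
        gcongr
      -- `1 < s^{K+1} M Bn^{k₀}`
      have hBpos : (0 : ℝ) < (Bn : ℝ) ^ k₀ := by positivity
      have hX : 1 < ‖t n‖ ^ (e * (D * k₀ + 1)) * M * (Bn : ℝ) ^ k₀ := by
        have h1 := lt_of_lt_of_le hlb' hup
        rw [inv_lt_iff_one_lt_mul₀ hBpos] at h1
        linarith [h1]
      -- the cusp scale `n ‖t n‖^e ≤ 1`
      have hsn : (n : ℝ) * ‖t n‖ ^ e ≤ 1 := by
        have hnorm : ‖2 * (π : ℂ) * I * (n : ℂ) + c n‖ = (‖t n‖ ^ e)⁻¹ := by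
          rw [← hn.2, norm_inv, norm_pow]
        have htri := norm_le_add_norm_add (2 * (π : ℂ) * I * (n : ℂ)) (c n)
        have h2pin : ‖2 * (π : ℂ) * I * (n : ℂ)‖ = 2 * π * n := by
          rw [norm_mul, h2piI, Complex.norm_natCast]
        rw [hnorm, h2pin] at htri
        have hπn : (3 : ℝ) * n ≤ π * n :=
          mul_le_mul_of_nonneg_right Real.pi_gt_three.le (Nat.cast_nonneg n)
        have hle : (n : ℝ) ≤ (‖t n‖ ^ e)⁻¹ := by linarith
        rw [inv_eq_one_div, le_div_iff₀ (pow_pos hs e)] at hle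
        exact hle
      have hbB : ((Bn : ℕ) : ℝ) ≤ (C₁ : ℝ) * (n : ℝ) ^ D := by rw [hBn]; push_cast; exact le_rfl
      exact bakerDepthCap_arith hs.le hM0 (by positivity) (by positivity) hn1' hsn hbB hnbig hX
  /- the late hits with vanishing form: at most one (`β ∉ ℚ`) -/
  obtain ⟨N₀, hN₀⟩ := eventually_atTop.mp key
  have hsub : Set.Subsingleton {n : ℕ | N₀ ≤ n ∧ ∃ L : ℤ,
      2 * ↑π * I * (L : ℂ) = 2 * ↑π * I * β * n + Φ (t n) + (β * l₀ - l₁)} := by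
    rintro n ⟨hn, L, hL⟩ m ⟨hm, L', hL'⟩
    by_contra hne
    have h1 := hN₀ n hn L hL
    have h2 := hN₀ m hm L' hL'
    have h3 : β * ((n : ℂ) - m) = (L : ℂ) - L' := by
      have h4 : (β * n - L) * (2 * ↑π * I) = (β * m - L') * (2 * ↑π * I) := by linear_combination h1 - h2
      have h5 := mul_right_cancel₀ h2pi h4
      linear_combination h5
    have hnm : ((n : ℂ) - m) ≠ 0 := by
      rw [sub_ne_zero]
      exact_mod_cast hne
    apply hβirr ((L - L') / ((n : ℚ) - m))
    push_cast
    rw [div_eq_iff hnm]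
    linear_combination -h3
  refine ((Set.finite_lt_nat N₀).union hsub.finite).subset ?_
  rintro n ⟨L, hL⟩
  by_cases hn : N₀ ≤ n
  · exact Or.inr ⟨hn, L, hL⟩
  · exact Or.inl (not_le.mp hn)

end Summit.Schanuel.Schanuel.Cruxes.SparsityTwo.CuspGermSchneiderSparsity
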